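import Summits.QuantumFields.BalabanUV.Beta.D1BFx.SectorRecut

/-!
# `BalabanUV.Beta.D1BFx.SplitRecut` — road «BF-x» for binder row D1, slot (SPLIT)∕(REST): THE RE-CUT REST WORD TABLE `restK'` (gluon bubble
# words over the Feynman-completed sectors `(SbT, SbL, SbRc)`, E-sector cross word over `SbT` — NO longitudinal word anywhere) AND THE (SPLIT)
# IDENTITY AT A BASE SITE FOR IT: `Σ_τ restK' τ = Σ_τ restK τ` pointwise, hence `ω_gl·Kf_gl + ω_gh·Kf_gh = stK μ ν N g + Σ_{τ : RestIdx} restK' τ`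

HONEST DEPENDENCY (page 1, mandatory): continuum YM on T⁴ ⇐ BetaPertH ∧ nine spine estimates (0/9 proved); BetaPertH ⇐ (D1) ∧ (D4) ∧
CAP+tail; G-an2-4 gates asym, D1 and NE2/3/4.  HONEST FRAMING (cell contract, verbatim): «discharging `BetaPertH` makes Bałaban's UV
stability UNCONDITIONAL — a real constructive-QFT result; it is NOT the continuum limit and NOT the Clay problem.»  THIS MODULE DISCHARGES
NOTHING of the wall: ONE definition with a body ([our object] `restK'`, the re-cut TERM LIST as data, same index `SplitInstance.RestIdx`, same
signature as `SplitInstance.restK`) and [folklore] finite-sum bookkeeping BY NAME over the owner's `SplitInstance.split_at_basePoint` ∕ `sum_restK` ∕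
`sum_eq_add_sum_ite_ne` (p220987) and `SectorRecut.gradedWordSum_eq_gradedWordSum'`.  No `Prop` is minted, nothing is cited, no hypothesis is a
printed statement, 0 sorry.  0 wall binders instantiated; NOT the (REST) bounds, NOT (K), NOT D1, NOT `BetaPertH`, NOT continuum, NOT Clay.

ABSOLUTE RULE (cell charter, verbatim): «No internally-minted statement may enter as a cited fact. Every hypothesis is either kernel-proved in
this package or a verbatim quotation of a PUBLISHED theorem with page reference. The manuscript(s) under audit are NOT citable for their own
disputed steps — they are the thing under adjudication; programme-internal (2001/route/tribunal) claims are never citable.»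

WHY (owner d1-p2 gen 3, FINDING «D1-BFx-LON-MISCUT», journal 2026-08-20 15:31:53Z; `D1BFx/SectorRecut` header).  The per-word n-uniform (REST)
hypotheses of the road's END must be individually satisfiable; the raw-sector cut is not (longitudinal log n split across four words).  `restK'`
is `restK` with (i) the 80 gluon bubble words re-indexed over `secSt' = (SbT, SbL, SbRc)` with weights `secWt' = (cE, cΛ, 1)`, and (ii) the
E-sector cross word `crossE' := ω_gl·cE²·n⁻⁸·w_μw_ν·(−½)·[bubble (frozenLeg g) (SbT μ (b+w)) (SbT ν b) − bubble (frozenLeg g) (VEC μ (b+w)) (VEC ν b)]`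
(= `VEC×REMₐ + REMₐ×VEC + REMₐ×REMₐ`: total grading ≥ 3, A2's degree-≥7 class); the tadpole words, the ghost words and the corner word are
`restK`'s VERBATIM (definitionally).  Since the total stencil is unchanged, `Σ_τ restK' τ w = Σ_τ restK τ w` for every `w`, and the (SPLIT)
identity of `SplitInstance` transfers to the re-cut list with the same hypotheses.

CONTENT.
* §1 [our object] **`restK'`**; unfoldings `restK'_tad`∕`_bub`∕`_gtad`∕`_gbub`∕`_corner`∕`_crossE`; `sum_restK'` (the sum over `RestIdx` as six pieces).
* §2 [folklore] **`sum_restK'_eq_sum_restK`** (pointwise in `w`; `0 < a`, `Spr (Ga n a)`, exponentially bounded profile);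
  **`split_at_basePoint_recut`** — `SplitInstance.split_at_basePoint` with `restK ↦ restK'`, hypotheses byte-identical.
Unit `b2b-balaban-beta-d1-p2` (road owner, gen 3); `LEAVES-BFx.md` rows (SPLIT)∕(REST) (re-cut).
-/

noncomputable section

namespace Summit.QuantumFields.BalabanUV.Beta.D1BFx.SplitRecut

open Finset
open scoped BigOperators
open Literature.MathematicalPhysics.QuantumFieldTheory.Balaban1983to89
open Literature.MathematicalPhysics.QuantumFieldTheory.Balaban1983to89.Beta
open B12Sec2to5 (l1)
open ExpKernelCalculus (Site MKer bubble)
open DyadicShell (Pt toReal)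
open BubbleTransfer (unitVec)
open SpinTable (bfKernel)
open SquareTable (stK)
open Summit.QuantumFields.BalabanUV.Beta.TameKernelCalculus (Spr Loc)
open Summit.QuantumFields.BalabanUV.Beta.D1BFx.MomentTransferPeriodic (baseKer)
open Summit.QuantumFields.BalabanUV.Beta.D1BFx.GluonLeg (Ga)
open Summit.QuantumFields.BalabanUV.Beta.D1BFx.ReducedKernel (TableR)
open Summit.QuantumFields.BalabanUV.Beta.D1BFx.DressedTablesLeg (tadpoleTableA)
open Summit.QuantumFields.BalabanUV.Beta.D1BFx.ReducedKernelSandwich (fineHess)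
open Summit.QuantumFields.BalabanUV.Beta.D1BFx.FineStencilBFBalaban (SbfBal)
open Summit.QuantumFields.BalabanUV.Beta.D1BFx.SecondStencilBF (Wbf)
open Summit.QuantumFields.BalabanUV.Beta.D1BFx.GluonKernelSectors (SbE secSt secWt secSt_zero secWt_zero)
open Summit.QuantumFields.BalabanUV.Beta.D1BFx.GhostStencilRootedReflection (ctrHalf)
open Summit.QuantumFields.BalabanUV.Beta.D1BFx.GhostAveragingSquare (WghAt)
open Summit.QuantumFields.BalabanUV.Beta.D1BFx.GhostKernelComplete (fineHessGhQ)
open Summit.QuantumFields.BalabanUV.Beta.D1BFx.FineHessianSectors (biBubbleTable biBubbleTable_apply slotWt slotTab)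
open Summit.QuantumFields.BalabanUV.Beta.D1BFx.FineHessianLegGrades (frozenLeg legPiece legPiece_zero)
open Summit.QuantumFields.BalabanUV.Beta.D1BFx.FineHessianGhostGrades (ghSec ghWt ghLeg)
open Summit.QuantumFields.BalabanUV.Beta.D1BFx.MainTable (vecK)
open Summit.QuantumFields.BalabanUV.Beta.D1BFx.SplitInstance (RestIdx restK restK_tad restK_bub restK_gtad restK_gbub restK_corner restK_crossE
  sum_restK sum_eq_add_sum_ite_ne split_at_basePoint)
open Summit.QuantumFields.BalabanUV.Beta.D1BFx.SectorRecut (SbT secSt' secWt' secSt'_zero secWt'_zero gradedWordSum_eq_gradedWordSum')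

/-! ## §1 The re-cut REST word table -/

section Words

/-- [our object] **THE RE-CUT REST WORD INTEGRANDS** at the base site `b`, displacement `w`: `SplitInstance.restK` with the gluon bubble words over
the Feynman-completed sectors `secSt' = (SbT, SbL, SbRc)` (weights `secWt' = (cE, cΛ, 1)`) and the E-sector cross word over `SbT`; every other
word is `restK`'s, verbatim.  A DEFINITION; asserts nothing. -/
noncomputable def restK' (n : ℕ) [NeZero n] (a : ℝ) (g : Pt → ℝ) (cE cΛ cR cK cQ cE₂ cJ4 cΛ₂ cR₂ cQ₂ x₀ : ℝ) (WE WJ WΛ WR WQ : TableR)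
    (ωgl ωgh lam N : ℝ) (μ ν : Fin 4) (b : Pt) : RestIdx → Pt → ℝ
  | Sum.inl x => restK n a g cE cΛ cR cK cQ cE₂ cJ4 cΛ₂ cR₂ cQ₂ x₀ WE WJ WΛ WR WQ ωgl ωgh lam N μ ν b (Sum.inl x)
  | Sum.inr (Sum.inl x) => fun w => ωgl * (if x = ((0 : Fin 3), (0 : Fin 3), (0 : Fin 3), (0 : Fin 3)) then 0 else
      secWt' cE cΛ x.1 * secWt' cE cΛ x.2.1 *
        (((n : ℝ) ^ 8)⁻¹ * (toReal w μ * toReal w ν *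
          baseKer (biBubbleTable (legPiece n a g x.2.2.1) (legPiece n a g x.2.2.2) (secSt' n a cE cR cK cQ x.1) (secSt' n a cE cR cK cQ x.2.1) μ ν)
            b w)))
  | Sum.inr (Sum.inr (Sum.inl r)) => restK n a g cE cΛ cR cK cQ cE₂ cJ4 cΛ₂ cR₂ cQ₂ x₀ WE WJ WΛ WR WQ ωgl ωgh lam N μ ν b (Sum.inr (Sum.inr (Sum.inl r)))
  | Sum.inr (Sum.inr (Sum.inr (Sum.inl x))) =>
      restK n a g cE cΛ cR cK cQ cE₂ cJ4 cΛ₂ cR₂ cQ₂ x₀ WE WJ WΛ WR WQ ωgl ωgh lam N μ ν b (Sum.inr (Sum.inr (Sum.inr (Sum.inl x))))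
  | Sum.inr (Sum.inr (Sum.inr (Sum.inr k))) => fun w => if k = 0 then
        restK n a g cE cΛ cR cK cQ cE₂ cJ4 cΛ₂ cR₂ cQ₂ x₀ WE WJ WΛ WR WQ ωgl ωgh lam N μ ν b (Sum.inr (Sum.inr (Sum.inr (Sum.inr 0)))) w
      else ωgl * (cE * cE * (((n : ℝ) ^ 8)⁻¹ * (toReal w μ * toReal w ν *
        (-(1 / 2 : ℝ) * (bubble (frozenLeg g : MKer 4 (Fin 4)) (SbT μ (b + w)) (SbT ν b)
          - bubble (frozenLeg g : MKer 4 (Fin 4)) (vecK μ (b + w)) (vecK ν b))))))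

variable (n : ℕ) [NeZero n] (a : ℝ) (g : Pt → ℝ) (cE cΛ cR cK cQ cE₂ cJ4 cΛ₂ cR₂ cQ₂ x₀ : ℝ) (WE WJ WΛ WR WQ : TableR)
  (ωgl ωgh lam N : ℝ) (μ ν : Fin 4) (b : Pt)

/-- [our object] Unfolding: gluon tadpole words (verbatim `restK`'s). -/
theorem restK'_tad (x : Fin 5 × Fin 3) (w : Pt) :
    restK' n a g cE cΛ cR cK cQ cE₂ cJ4 cΛ₂ cR₂ cQ₂ x₀ WE WJ WΛ WR WQ ωgl ωgh lam N μ ν b (Sum.inl x) w =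
      ωgl * (slotWt cE₂ cJ4 cΛ₂ cR₂ cQ₂ x.1 *
        (((n : ℝ) ^ 8)⁻¹ * (toReal w μ * toReal w ν * baseKer (tadpoleTableA (legPiece n a g x.2) (slotTab WE WJ WΛ WR WQ x.1) μ ν) b w))) := rfl

/-- [our object] Unfolding: the RE-CUT gluon bubble words (the `0000` word replaced by `0`). -/
theorem restK'_bub (x : Fin 3 × Fin 3 × Fin 3 × Fin 3) (w : Pt) :
    restK' n a g cE cΛ cR cK cQ cE₂ cJ4 cΛ₂ cR₂ cQ₂ x₀ WE WJ WΛ WR WQ ωgl ωgh lam N μ ν b (Sum.inr (Sum.inl x)) w =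
      ωgl * (if x = ((0 : Fin 3), (0 : Fin 3), (0 : Fin 3), (0 : Fin 3)) then 0 else
        secWt' cE cΛ x.1 * secWt' cE cΛ x.2.1 *
          (((n : ℝ) ^ 8)⁻¹ * (toReal w μ * toReal w ν *
            baseKer (biBubbleTable (legPiece n a g x.2.2.1) (legPiece n a g x.2.2.2) (secSt' n a cE cR cK cQ x.1) (secSt' n a cE cR cK cQ x.2.1) μ ν)
              b w))) := rfl

/-- [our object] Unfolding: ghost tadpole words (verbatim `restK`'s). -/
theorem restK'_gtad (r : Fin 2) (w : Pt) :
    restK' n a g cE cΛ cR cK cQ cE₂ cJ4 cΛ₂ cR₂ cQ₂ x₀ WE WJ WΛ WR WQ ωgl ωgh lam N μ ν b (Sum.inr (Sum.inr (Sum.inl r))) w =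
      ωgh * (((n : ℝ) ^ 8)⁻¹ * (toReal w μ * toReal w ν * baseKer (tadpoleTableA (ghLeg n a g r) (WghAt (ctrHalf n) n x₀ cK cQ) μ ν) b w)) := rfl

/-- [our object] Unfolding: ghost bubble words (verbatim `restK`'s). -/
theorem restK'_gbub (x : Fin 2 × Fin 2 × Fin 2 × Fin 2) (w : Pt) :
    restK' n a g cE cΛ cR cK cQ cE₂ cJ4 cΛ₂ cR₂ cQ₂ x₀ WE WJ WΛ WR WQ ωgl ωgh lam N μ ν b (Sum.inr (Sum.inr (Sum.inr (Sum.inl x)))) w =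
      ωgh * (if x = ((0 : Fin 2), (0 : Fin 2), (0 : Fin 2), (0 : Fin 2)) then 0 else
        ghWt cK cQ x.1 * ghWt cK cQ x.2.1 *
          (((n : ℝ) ^ 8)⁻¹ * (toReal w μ * toReal w ν *
            baseKer (biBubbleTable (ghLeg n a g x.2.2.1) (ghLeg n a g x.2.2.2) (ghSec n x.1) (ghSec n x.2.1) μ ν) b w))) := rfl

/-- [our object] Unfolding: the corner word (verbatim `restK`'s). -/
theorem restK'_corner (w : Pt) :
    restK' n a g cE cΛ cR cK cQ cE₂ cJ4 cΛ₂ cR₂ cQ₂ x₀ WE WJ WΛ WR WQ ωgl ωgh lam N μ ν b (Sum.inr (Sum.inr (Sum.inr (Sum.inr 0)))) w =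
      ((n : ℝ) ^ 8)⁻¹ * (toReal w μ * toReal w ν * (lam * bfKernel g N (unitVec μ) (unitVec ν) (-w - unitVec μ))) - stK μ ν N g w := rfl

/-- [our object] Unfolding: the RE-CUT E-sector cross word (over `SbT = VEC + REMₐ`: no longitudinal word). -/
theorem restK'_crossE (w : Pt) :
    restK' n a g cE cΛ cR cK cQ cE₂ cJ4 cΛ₂ cR₂ cQ₂ x₀ WE WJ WΛ WR WQ ωgl ωgh lam N μ ν b (Sum.inr (Sum.inr (Sum.inr (Sum.inr 1)))) w =
      ωgl * (cE * cE * (((n : ℝ) ^ 8)⁻¹ * (toReal w μ * toReal w ν *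
        (-(1 / 2 : ℝ) * (bubble (frozenLeg g : MKer 4 (Fin 4)) (SbT μ (b + w)) (SbT ν b)
          - bubble (frozenLeg g : MKer 4 (Fin 4)) (vecK μ (b + w)) (vecK ν b)))))) := rfl

/-- [our object] On every range except the gluon bubble words and the cross word, `restK'` IS `restK` (definitionally): tadpoles. -/
theorem restK'_tad_eq (x : Fin 5 × Fin 3) :
    restK' n a g cE cΛ cR cK cQ cE₂ cJ4 cΛ₂ cR₂ cQ₂ x₀ WE WJ WΛ WR WQ ωgl ωgh lam N μ ν b (Sum.inl x) =
      restK n a g cE cΛ cR cK cQ cE₂ cJ4 cΛ₂ cR₂ cQ₂ x₀ WE WJ WΛ WR WQ ωgl ωgh lam N μ ν b (Sum.inl x) := rfl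

/-- [our object] … ghost tadpoles. -/
theorem restK'_gtad_eq (r : Fin 2) :
    restK' n a g cE cΛ cR cK cQ cE₂ cJ4 cΛ₂ cR₂ cQ₂ x₀ WE WJ WΛ WR WQ ωgl ωgh lam N μ ν b (Sum.inr (Sum.inr (Sum.inl r))) =
      restK n a g cE cΛ cR cK cQ cE₂ cJ4 cΛ₂ cR₂ cQ₂ x₀ WE WJ WΛ WR WQ ωgl ωgh lam N μ ν b (Sum.inr (Sum.inr (Sum.inl r))) := rfl

/-- [our object] … ghost bubbles. -/
theorem restK'_gbub_eq (x : Fin 2 × Fin 2 × Fin 2 × Fin 2) :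
    restK' n a g cE cΛ cR cK cQ cE₂ cJ4 cΛ₂ cR₂ cQ₂ x₀ WE WJ WΛ WR WQ ωgl ωgh lam N μ ν b (Sum.inr (Sum.inr (Sum.inr (Sum.inl x)))) =
      restK n a g cE cΛ cR cK cQ cE₂ cJ4 cΛ₂ cR₂ cQ₂ x₀ WE WJ WΛ WR WQ ωgl ωgh lam N μ ν b (Sum.inr (Sum.inr (Sum.inr (Sum.inl x)))) := rfl

/-- [our object] … the corner word. -/
theorem restK'_corner_eq :
    restK' n a g cE cΛ cR cK cQ cE₂ cJ4 cΛ₂ cR₂ cQ₂ x₀ WE WJ WΛ WR WQ ωgl ωgh lam N μ ν b (Sum.inr (Sum.inr (Sum.inr (Sum.inr 0)))) =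
      restK n a g cE cΛ cR cK cQ cE₂ cJ4 cΛ₂ cR₂ cQ₂ x₀ WE WJ WΛ WR WQ ωgl ωgh lam N μ ν b (Sum.inr (Sum.inr (Sum.inr (Sum.inr 0)))) := by
  funext w; rfl

/-- [folklore] **THE SUM OVER THE REST INDEX OF THE RE-CUT TABLE AS SIX EXPLICIT PIECES.** -/
theorem sum_restK' (w : Pt) :
    ∑ τ : RestIdx, restK' n a g cE cΛ cR cK cQ cE₂ cJ4 cΛ₂ cR₂ cQ₂ x₀ WE WJ WΛ WR WQ ωgl ωgh lam N μ ν b τ w =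
      ωgl * (∑ x : Fin 5 × Fin 3, slotWt cE₂ cJ4 cΛ₂ cR₂ cQ₂ x.1 *
        (((n : ℝ) ^ 8)⁻¹ * (toReal w μ * toReal w ν * baseKer (tadpoleTableA (legPiece n a g x.2) (slotTab WE WJ WΛ WR WQ x.1) μ ν) b w)))
      + ωgl * (∑ x : Fin 3 × Fin 3 × Fin 3 × Fin 3, if x = ((0 : Fin 3), (0 : Fin 3), (0 : Fin 3), (0 : Fin 3)) then 0 else
          secWt' cE cΛ x.1 * secWt' cE cΛ x.2.1 *
            (((n : ℝ) ^ 8)⁻¹ * (toReal w μ * toReal w ν *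
              baseKer (biBubbleTable (legPiece n a g x.2.2.1) (legPiece n a g x.2.2.2) (secSt' n a cE cR cK cQ x.1) (secSt' n a cE cR cK cQ x.2.1)
                μ ν) b w)))
      + ωgh * (∑ r : Fin 2, ((n : ℝ) ^ 8)⁻¹ * (toReal w μ * toReal w ν * baseKer (tadpoleTableA (ghLeg n a g r) (WghAt (ctrHalf n) n x₀ cK cQ) μ ν) b w))
      + ωgh * (∑ x : Fin 2 × Fin 2 × Fin 2 × Fin 2, if x = ((0 : Fin 2), (0 : Fin 2), (0 : Fin 2), (0 : Fin 2)) then 0 else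
          ghWt cK cQ x.1 * ghWt cK cQ x.2.1 *
            (((n : ℝ) ^ 8)⁻¹ * (toReal w μ * toReal w ν *
              baseKer (biBubbleTable (ghLeg n a g x.2.2.1) (ghLeg n a g x.2.2.2) (ghSec n x.1) (ghSec n x.2.1) μ ν) b w)))
      + ((((n : ℝ) ^ 8)⁻¹ * (toReal w μ * toReal w ν * (lam * bfKernel g N (unitVec μ) (unitVec ν) (-w - unitVec μ))) - stK μ ν N g w)
        + ωgl * (cE * cE * (((n : ℝ) ^ 8)⁻¹ * (toReal w μ * toReal w ν *
          (-(1 / 2 : ℝ) * (bubble (frozenLeg g : MKer 4 (Fin 4)) (SbT μ (b + w)) (SbT ν b)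
            - bubble (frozenLeg g : MKer 4 (Fin 4)) (vecK μ (b + w)) (vecK ν b))))))) := by
  rw [Fintype.sum_sum_type, Fintype.sum_sum_type, Fintype.sum_sum_type, Fintype.sum_sum_type]
  have hk : ∑ k : Fin 2, restK' n a g cE cΛ cR cK cQ cE₂ cJ4 cΛ₂ cR₂ cQ₂ x₀ WE WJ WΛ WR WQ ωgl ωgh lam N μ ν b (Sum.inr (Sum.inr (Sum.inr (Sum.inr k)))) w
      = restK' n a g cE cΛ cR cK cQ cE₂ cJ4 cΛ₂ cR₂ cQ₂ x₀ WE WJ WΛ WR WQ ωgl ωgh lam N μ ν b (Sum.inr (Sum.inr (Sum.inr (Sum.inr 0)))) w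
        + restK' n a g cE cΛ cR cK cQ cE₂ cJ4 cΛ₂ cR₂ cQ₂ x₀ WE WJ WΛ WR WQ ωgl ωgh lam N μ ν b (Sum.inr (Sum.inr (Sum.inr (Sum.inr 1)))) w :=
    Fin.sum_univ_two _
  rw [hk, restK'_corner, restK'_crossE]
  simp only [restK'_tad, restK'_bub, restK'_gtad, restK'_gbub, ← Finset.mul_sum]
  ring

end Words

/-! ## §2 The re-cut REST sum equals the raw REST sum; the (SPLIT) identity for the re-cut table -/

section Split

variable (n : ℕ) [NeZero n] (a : ℝ) {g : Pt → ℝ} (cE cVH cΛ cR cK cQ cE₂ cJ4 cΛ₂ cR₂ cQ₂ x₀ : ℝ) (WE WJ WΛ WR WQ : TableR)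
  (ωgl ωgh lam N : ℝ) (μ ν : Fin 4)

/-- [folklore] **THE RE-CUT REST SUM IS THE RAW REST SUM, POINTWISE**: `Σ_τ restK' … b τ w = Σ_τ restK … b τ w` for every base site `b` and
displacement `w` (`0 < a`, `Spr (Ga n a)`, exponentially bounded profile `g`) — the 81 graded bubble words re-sum (`SectorRecut`), and the two
`0000` words absorbed by the cross words compensate. -/
theorem sum_restK'_eq_sum_restK (ha : 0 < a) (hGa : Spr (Ga n a)) {C δ : ℝ} (hδ : 0 < δ) (hg : ∀ v, |g v| ≤ C * Real.exp (-δ * l1 v))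
    (b w : Pt) :
    ∑ τ : RestIdx, restK' n a g cE cΛ cR cK cQ cE₂ cJ4 cΛ₂ cR₂ cQ₂ x₀ WE WJ WΛ WR WQ ωgl ωgh lam N μ ν b τ w =
      ∑ τ : RestIdx, restK n a g cE cΛ cR cK cQ cE₂ cJ4 cΛ₂ cR₂ cQ₂ x₀ WE WJ WΛ WR WQ ωgl ωgh lam N μ ν b τ w := by
  -- the two full 81-word sums and their `0000` words
  set W : Fin 3 × Fin 3 × Fin 3 × Fin 3 → ℝ := fun x => secWt cE cΛ cR x.1 * secWt cE cΛ cR x.2.1 * (((n : ℝ) ^ 8)⁻¹ *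
      (toReal w μ * toReal w ν * baseKer (biBubbleTable (legPiece n a g x.2.2.1) (legPiece n a g x.2.2.2) (secSt n a cK cQ x.1)
        (secSt n a cK cQ x.2.1) μ ν) b w)) with hWdef
  set W' : Fin 3 × Fin 3 × Fin 3 × Fin 3 → ℝ := fun x => secWt' cE cΛ x.1 * secWt' cE cΛ x.2.1 * (((n : ℝ) ^ 8)⁻¹ *
      (toReal w μ * toReal w ν * baseKer (biBubbleTable (legPiece n a g x.2.2.1) (legPiece n a g x.2.2.2) (secSt' n a cE cR cK cQ x.1)
        (secSt' n a cE cR cK cQ x.2.1) μ ν) b w)) with hW'def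
  have htot : ∑ x, W x = ∑ x, W' x := gradedWordSum_eq_gradedWordSum' n a cE cΛ cR cK cQ ha hGa hδ hg μ ν b w
  have hsplitW : ∑ x, W x = W ((0 : Fin 3), (0 : Fin 3), (0 : Fin 3), (0 : Fin 3)) + ∑ x, (if x = ((0 : Fin 3), (0 : Fin 3), (0 : Fin 3), (0 : Fin 3))
      then 0 else W x) := sum_eq_add_sum_ite_ne W _
  have hsplitW' : ∑ x, W' x = W' ((0 : Fin 3), (0 : Fin 3), (0 : Fin 3), (0 : Fin 3)) + ∑ x, (if x = ((0 : Fin 3), (0 : Fin 3), (0 : Fin 3), (0 : Fin 3))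
      then 0 else W' x) := sum_eq_add_sum_ite_ne W' _
  -- the two isolated words in explicit form
  have e0 : W ((0 : Fin 3), (0 : Fin 3), (0 : Fin 3), (0 : Fin 3)) =
      cE * cE * (((n : ℝ) ^ 8)⁻¹ * (toReal w μ * toReal w ν * (-(1 / 2 : ℝ) * bubble (frozenLeg g : MKer 4 (Fin 4)) (SbE μ (b + w)) (SbE ν b)))) := by
    rw [hWdef]
    dsimp only
    rw [secWt_zero, secSt_zero, legPiece_zero, baseKer, biBubbleTable_apply]
    rfl
  have e0' : W' ((0 : Fin 3), (0 : Fin 3), (0 : Fin 3), (0 : Fin 3)) =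
      cE * cE * (((n : ℝ) ^ 8)⁻¹ * (toReal w μ * toReal w ν * (-(1 / 2 : ℝ) * bubble (frozenLeg g : MKer 4 (Fin 4)) (SbT μ (b + w)) (SbT ν b)))) := by
    rw [hW'def]
    dsimp only
    rw [secWt'_zero, secSt'_zero, legPiece_zero, baseKer, biBubbleTable_apply]
    rfl
  rw [sum_restK', sum_restK]
  have hite : ∑ x, (if x = ((0 : Fin 3), (0 : Fin 3), (0 : Fin 3), (0 : Fin 3)) then 0 else W' x)
      + cE * cE * (((n : ℝ) ^ 8)⁻¹ * (toReal w μ * toReal w ν * (-(1 / 2 : ℝ) * bubble (frozenLeg g : MKer 4 (Fin 4)) (SbT μ (b + w)) (SbT ν b))))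
      = ∑ x, (if x = ((0 : Fin 3), (0 : Fin 3), (0 : Fin 3), (0 : Fin 3)) then 0 else W x)
      + cE * cE * (((n : ℝ) ^ 8)⁻¹ * (toReal w μ * toReal w ν * (-(1 / 2 : ℝ) * bubble (frozenLeg g : MKer 4 (Fin 4)) (SbE μ (b + w)) (SbE ν b)))) := by
    rw [← e0, ← e0']
    linarith [htot, hsplitW, hsplitW']
  have hW_ite : (∑ x : Fin 3 × Fin 3 × Fin 3 × Fin 3, if x = ((0 : Fin 3), (0 : Fin 3), (0 : Fin 3), (0 : Fin 3)) then 0 else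
      secWt cE cΛ cR x.1 * secWt cE cΛ cR x.2.1 * (((n : ℝ) ^ 8)⁻¹ * (toReal w μ * toReal w ν *
        baseKer (biBubbleTable (legPiece n a g x.2.2.1) (legPiece n a g x.2.2.2) (secSt n a cK cQ x.1) (secSt n a cK cQ x.2.1) μ ν) b w)))
      = ∑ x, (if x = ((0 : Fin 3), (0 : Fin 3), (0 : Fin 3), (0 : Fin 3)) then 0 else W x) := by
    rw [hWdef]
  have hW'_ite : (∑ x : Fin 3 × Fin 3 × Fin 3 × Fin 3, if x = ((0 : Fin 3), (0 : Fin 3), (0 : Fin 3), (0 : Fin 3)) then 0 else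
      secWt' cE cΛ x.1 * secWt' cE cΛ x.2.1 * (((n : ℝ) ^ 8)⁻¹ * (toReal w μ * toReal w ν *
        baseKer (biBubbleTable (legPiece n a g x.2.2.1) (legPiece n a g x.2.2.2) (secSt' n a cE cR cK cQ x.1) (secSt' n a cE cR cK cQ x.2.1) μ ν)
          b w)))
      = ∑ x, (if x = ((0 : Fin 3), (0 : Fin 3), (0 : Fin 3), (0 : Fin 3)) then 0 else W' x) := by
    rw [hW'def]
  rw [hW_ite, hW'_ite]
  linear_combination ωgl * hite

/-- [folklore] **THE (SPLIT) IDENTITY AT A BASE SITE FOR THE RE-CUT TABLE** — `SplitInstance.split_at_basePoint` with `restK ↦ restK'`, same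
hypotheses (`0 < a`, `Spr (Ga n a)`, profile exponentially bounded and even, `Loc` of the five slot tables, `μ ≠ ν`, loop-weight ratio `hω`,
normalisation `hlam`): for every displacement `w`,
`ω_gl·[n⁻⁸·w_μw_ν·baseKer (fineHess n a SbfBal Wbf μ ν) b w] + ω_gh·[n⁻⁸·w_μw_ν·baseKer (fineHessGhQ n a x₀ cK cQ μ ν) b w] = stK μ ν N g w + Σ_{τ : RestIdx} restK' … τ w`. -/
theorem split_at_basePoint_recut (ha : 0 < a) (hGa : Spr (Ga n a)) {C δ : ℝ} (hδ : 0 < δ) (hg : ∀ v, |g v| ≤ C * Real.exp (-δ * l1 v))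
    (hgev : ∀ w, g (-w) = g w) (hE : ∀ κ u l u', Loc (WE κ u l u')) (hJ : ∀ κ u l u', Loc (WJ κ u l u'))
    (hΛ : ∀ κ u l u', Loc (WΛ κ u l u')) (hR : ∀ κ u l u', Loc (WR κ u l u')) (hQ : ∀ κ u l u', Loc (WQ κ u l u'))
    (hμν : μ ≠ ν) (hω : ωgh * cK ^ 2 = -2 * (ωgl * cE ^ 2)) (hlam : ωgl * cE ^ 2 = 2 * N ^ 2 * lam) (b w : Pt) :
    ωgl * (((n : ℝ) ^ 8)⁻¹ * (toReal w μ * toReal w ν *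
        baseKer (fineHess n a (SbfBal n a cE cVH cΛ cR cK cQ) (Wbf cE₂ cJ4 cΛ₂ cR₂ cQ₂ WE WJ WΛ WR WQ) μ ν) b w))
      + ωgh * (((n : ℝ) ^ 8)⁻¹ * (toReal w μ * toReal w ν * baseKer (fineHessGhQ n a x₀ cK cQ μ ν) b w)) =
      stK μ ν N g w + ∑ τ : RestIdx, restK' n a g cE cΛ cR cK cQ cE₂ cJ4 cΛ₂ cR₂ cQ₂ x₀ WE WJ WΛ WR WQ ωgl ωgh lam N μ ν b τ w := by
  rw [sum_restK'_eq_sum_restK n a cE cΛ cR cK cQ cE₂ cJ4 cΛ₂ cR₂ cQ₂ x₀ WE WJ WΛ WR WQ ωgl ωgh lam N μ ν ha hGa hδ hg b w]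
  exact split_at_basePoint n a cE cVH cΛ cR cK cQ cE₂ cJ4 cΛ₂ cR₂ cQ₂ x₀ WE WJ WΛ WR WQ ha hGa hδ hg hgev hE hJ hΛ hR hQ hμν hω hlam b w

end Split

end Summit.QuantumFields.BalabanUV.Beta.D1BFx.SplitRecut

end
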